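import Summits.FinalStateConjecture.FinalStateConjecture.Theses.BondiDrainDispersal
import Summits.FinalStateConjecture.FinalStateConjecture.Theorems.BondiDrainDispersalHorizonlessMustDrainLogicTier
import Summits.FinalStateConjecture.FinalStateConjecture.Theorems.BondiDrainDispersalHorizonlessMustDrainTrappedHorizon
import Literature.Geometry.Lorentzian.TrappedSurface
import HarnessLib

/-!
# Strategy census s4 (independent, family `s`) — crux `HorizonlessMustDrain` (stmt-FinalStateConjecture-9976)

Typed signatures for the census `STRATEGY-CENSUS-s4.md`: the weaker intermediate the route's `closes`
actually consumes (CK restriction, with the re-glue PROVED), the trapped-surface "strengthening" of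
Christodoulou-1991 shape and why its relativised form is the crux in costume (both directions proved
modulo the censorship lemma `TrappedHasHorizon`), and the uniformly-non-trapped intermediate (the first
non-transferring step of the spherical Einstein–scalar proof).  Nothing here is a route item; nothing is
proposed to the tree.  Sorry-free.
-/

set_option linter.dupNamespace false
set_option linter.unusedVariables false

noncomputable section

open scoped Manifold ContDiff Topology
open Set Function Literature.Geometry.Lorentzian

namespace Summit.FinalStateConjecture.FinalStateConjecture.Cruxes.HorizonlessMustDrain.CensusS4

open Summit.FinalStateConjecture.FinalStateConjecture.Theses.BondiDrainDispersal
  (HorizonlessMustDrain DrainImpliesDisperseCKH CensoredHorizonlessDisperseCK GenericCensoredHolesOrRoughSettle)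

/-! ## Abbreviations (verbatim sub-formulae of the route decls) -/

section Abbrev

variable {X : Type} [TopologicalSpace X] [ChartedSpace E3 X] [IsManifold (𝓡 3) ∞ X] [T2Space X]
  [SecondCountableTopology X] [ConnectedSpace X] {D : InitialDataSet (𝓡 3) X}

/-- The typed ray-theoretic EVENT HORIZON clause of the route (some event outside the chronological past of
every future-complete normalised null ray from the data). -/
abbrev HasHorizon (𝒟 : VacuumCauchyDevelopment D) : Prop :=
  ∀ [𝒟.metric.HasLeviCivita], ∃ q : 𝒟.carrier, ∀ (p : X) (γ : ℝ → 𝒟.carrier) (dom : Set ℝ),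
    𝒟.metric.IsNormalisedNullRayFrom 𝒟.timeOrientation 𝒟.embed 𝒟.normal p γ dom → ¬ BddAbove dom →
      q ∉ 𝒟.metric.chronologicalPast 𝒟.timeOrientation (γ '' (dom ∩ Set.Ici 0))

/-- Future causal geodesic completeness of the development (the sector predicate of p157550). -/
abbrev IsFutureComplete (𝒟 : VacuumCauchyDevelopment D) : Prop :=
  ∀ [𝒟.metric.HasLeviCivita], ¬ 𝒟.metric.IsFutureNullGeodesicallyIncomplete 𝒟.timeOrientation ∧
    ¬ 𝒟.metric.IsFutureTimelikeGeodesicallyIncomplete 𝒟.timeOrientation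

/-- A closed trapped 2-sphere to the causal future of the data (binder form of p164880). -/
abbrev HasTrappedSphere (𝒟 : VacuumCauchyDevelopment D) : Prop :=
  ∀ [𝒟.metric.HasLeviCivita], ∃ f : Metric.sphere (0 : E3) 1 → 𝒟.carrier,
    Set.range f ⊆ 𝒟.metric.causalFuture 𝒟.timeOrientation (Set.range 𝒟.embed) ∧
      𝒟.metric.IsTrappedSurface (𝓡 2) 𝒟.timeOrientation f

/-- The Christodoulou–Klainerman data clause of the rev-7 cruxes. -/
abbrev IsCKDatum (D : InitialDataSet (𝓡 3) X) : Prop :=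
  ∃ (e : AFEnd X) (M : ℝ), e.IsSoleEnd ∧ e.IsStronglyAsymptoticallyFlatCK D M

end Abbrev

/-! ## W1 — the weaker intermediate `closes` actually consumes: the CK restriction -/

/-- **W1 `HorizonlessMustDrainCK`**: the crux restricted to admissible data with a sole strongly asymptotically flat
CK end — literally the only instances `closes` uses (`hM X D hD 𝒟 h𝒟 hI hH` under `hCK`). -/
def HorizonlessMustDrainCK : Prop :=
  ∀ (X : Type) [TopologicalSpace X] [ChartedSpace E3 X] [IsManifold (𝓡 3) ∞ X] [T2Space X]
    [SecondCountableTopology X] [ConnectedSpace X],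
    ∀ D ∈ admissibleVacuumData X, IsCKDatum D → ∀ 𝒟 : VacuumCauchyDevelopment D, 𝒟.IsMaximal →
      Summit.FinalStateConjecture.HasCompleteNullInfinity 𝒟.toCauchyDevelopment → ¬ HasHorizon 𝒟 →
        𝒟.toCauchyDevelopment.HasVanishingFinalBondiMass

/-- The crux gives its CK restriction (one line). -/
theorem horizonlessMustDrainCK_of_crux (h : HorizonlessMustDrain) : HorizonlessMustDrainCK :=
  fun X _ _ _ _ _ _ D hD _ 𝒟 h𝒟 hI hH ↦ h X D hD 𝒟 h𝒟 hI hH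

/-- W1 composes with the rank-2 crux to the composite rank-3 item exactly as in `closes`. -/
theorem censoredHorizonlessDisperseCK_of_ck (hM : HorizonlessMustDrainCK) (hΔ : DrainImpliesDisperseCKH) :
    CensoredHorizonlessDisperseCK := by
  intro X _ _ _ _ _ _ D hD hCK 𝒟 h𝒟 hI hH
  exact hΔ X D hD hCK 𝒟 h𝒟 hI hH (hM X D hD hCK 𝒟 h𝒟 hI hH)

/-- **The CK-restricted crux already decides the summit with the other two cruxes** (the body of the route's
`closes`, rev 7/8, with `hM` replaced by W1; pure logic).  Hence the ∀-DR-data quantifier of the crux as typed is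
idle strength: a tenure `--restate` to the CK class changes nothing in the cone. -/
theorem closes_of_ck : HorizonlessMustDrainCK → DrainImpliesDisperseCKH → GenericCensoredHolesOrRoughSettle →
    _root_.FinalStateConjecture := by
  intro hM hΔ hG
  have hA : CensoredHorizonlessDisperseCK := censoredHorizonlessDisperseCK_of_ck hM hΔ
  intro X _ _ _ _ _ _ D hD
  have key : ∀ D' ∈ Literature.Geometry.Lorentzian.admissibleVacuumData X,
      ((∃ 𝒟 : Literature.Geometry.Lorentzian.VacuumCauchyDevelopment D', 𝒟.IsMaximal) ∧
        ∀ 𝒟 : Literature.Geometry.Lorentzian.VacuumCauchyDevelopment D', 𝒟.IsMaximal →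
          Summit.FinalStateConjecture.HasCompleteNullInfinity 𝒟.toCauchyDevelopment ∧
          (((∀ [𝒟.metric.HasLeviCivita], ∃ q : 𝒟.carrier, ∀ (p : X) (γ : ℝ → 𝒟.carrier) (dom : Set ℝ),
              𝒟.metric.IsNormalisedNullRayFrom 𝒟.timeOrientation 𝒟.embed 𝒟.normal p γ dom →
              ¬ BddAbove dom → q ∉ 𝒟.metric.chronologicalPast 𝒟.timeOrientation (γ '' (dom ∩ Set.Ici 0))) ∨
            ¬ (∃ (e : Literature.Geometry.Lorentzian.AFEnd X) (M : ℝ),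
                e.IsSoleEnd ∧ e.IsStronglyAsymptoticallyFlatCK D' M)) →
            ∃ (O : Set 𝒟.carrier) (d : Literature.Geometry.Lorentzian.FinalStateDecomposition 𝒟.toSpacetime O 2),
              (∀ i, Literature.Geometry.Lorentzian.Kerr.IsSubextremal (d.mass i) (d.spin i)) ∧
              O = Summit.FinalStateConjecture.exteriorOf 𝒟.toCauchyDevelopment d.charted ∧
              Summit.FinalStateConjecture.RaysStayInClosure 𝒟.toCauchyDevelopment O ∧
              Summit.FinalStateConjecture.HasExhaustiveCharts d ∧
              Summit.FinalStateConjecture.IsFutureOriented d)) →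
      ((∃ 𝒟 : Literature.Geometry.Lorentzian.VacuumCauchyDevelopment D', 𝒟.IsMaximal) ∧
        ∀ 𝒟 : Literature.Geometry.Lorentzian.VacuumCauchyDevelopment D', 𝒟.IsMaximal →
          Summit.FinalStateConjecture.HasCompleteNullInfinity 𝒟.toCauchyDevelopment ∧
            ∃ (O : Set 𝒟.carrier) (d : Literature.Geometry.Lorentzian.FinalStateDecomposition 𝒟.toSpacetime O 2),
              (∀ i, Literature.Geometry.Lorentzian.Kerr.IsSubextremal (d.mass i) (d.spin i)) ∧
              O = Summit.FinalStateConjecture.exteriorOf 𝒟.toCauchyDevelopment d.charted ∧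
              Summit.FinalStateConjecture.RaysStayInClosure 𝒟.toCauchyDevelopment O ∧
              Summit.FinalStateConjecture.HasExhaustiveCharts d ∧
              Summit.FinalStateConjecture.IsFutureOriented d) := by
    intro D' hD' h
    refine ⟨h.1, fun 𝒟 h𝒟 ↦ ⟨(h.2 𝒟 h𝒟).1, ?_⟩⟩
    by_cases hH : (∀ [𝒟.metric.HasLeviCivita], ∃ q : 𝒟.carrier, ∀ (p : X) (γ : ℝ → 𝒟.carrier) (dom : Set ℝ),
        𝒟.metric.IsNormalisedNullRayFrom 𝒟.timeOrientation 𝒟.embed 𝒟.normal p γ dom →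
        ¬ BddAbove dom → q ∉ 𝒟.metric.chronologicalPast 𝒟.timeOrientation (γ '' (dom ∩ Set.Ici 0)))
    · exact (h.2 𝒟 h𝒟).2 (Or.inl hH)
    · by_cases hCK : ∃ (e : Literature.Geometry.Lorentzian.AFEnd X) (M : ℝ),
          e.IsSoleEnd ∧ e.IsStronglyAsymptoticallyFlatCK D' M
      · obtain ⟨O, d, hN, hO, hR, hE, hF⟩ := hA X D' hD' hCK 𝒟 h𝒟 (h.2 𝒟 h𝒟).1 hH
        exact ⟨O, d, fun i ↦ (Fin.cast hN i).elim0, hO, hR, hE, hF⟩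
      · exact (h.2 𝒟 h𝒟).2 (Or.inr hCK)
  obtain ⟨e, F, hT, hImm, h0, hinj, hF𝓓, hE⟩ := hG X D ⟨hD.1, fun h ↦ hD.2 (key D hD.1 h)⟩
  exact ⟨e, F, hT, hImm, h0, hinj, hF𝓓, fun c hc hmem ↦ hE c hc ⟨hmem.1, fun h ↦ hmem.2 (key _ hmem.1 h)⟩⟩

/-! ## S⁺ / D2 — the trapped-surface strengthening (Christodoulou 1991 shape) and why its relativisation is costume -/

/-- **S⁺1 `PersistentMassTraps`** (the spherical sibling's theorem, Christodoulou CMP 109 (1987) / CPAM 44 (1991),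
transplanted verbatim: positive final Bondi mass ⇒ a closed trapped surface forms): every censored MGHD of an
admissible datum which does NOT have vanishing final Bondi mass contains a closed trapped 2-sphere to the causal
future of the data.  NOT relativised to horizonless developments — and therefore threatened by extremal-horizon
formation (a censored development settling to exact extremal Kerr keeps `M_∞ > 0` without, conjecturally, any
closed trapped surface; Kehle–Unger, arXiv:2304.08455 Rem. 1.5; arXiv:2211.15742). -/
def PersistentMassTraps : Prop :=
  ∀ (X : Type) [TopologicalSpace X] [ChartedSpace E3 X] [IsManifold (𝓡 3) ∞ X] [T2Space X]
    [SecondCountableTopology X] [ConnectedSpace X],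
    ∀ D ∈ admissibleVacuumData X, ∀ 𝒟 : VacuumCauchyDevelopment D, 𝒟.IsMaximal →
      Summit.FinalStateConjecture.HasCompleteNullInfinity 𝒟.toCauchyDevelopment →
        ¬ 𝒟.toCauchyDevelopment.HasVanishingFinalBondiMass → HasTrappedSphere 𝒟

/-- **S⁺1ʰ `PersistentMassTrapsH`**: the same, relativised to HORIZONLESS censored developments. -/
def PersistentMassTrapsH : Prop :=
  ∀ (X : Type) [TopologicalSpace X] [ChartedSpace E3 X] [IsManifold (𝓡 3) ∞ X] [T2Space X]
    [SecondCountableTopology X] [ConnectedSpace X],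
    ∀ D ∈ admissibleVacuumData X, ∀ 𝒟 : VacuumCauchyDevelopment D, 𝒟.IsMaximal →
      Summit.FinalStateConjecture.HasCompleteNullInfinity 𝒟.toCauchyDevelopment → ¬ HasHorizon 𝒟 →
        ¬ 𝒟.toCauchyDevelopment.HasVanishingFinalBondiMass → HasTrappedSphere 𝒟

/-- **`TrappedHasHorizon`** (Hawking–Ellis 1973 Prop. 9.2.1 / Wald 1984 Prop. 12.2.2 in the typed sojourn form): a
censored MGHD of an admissible datum with a closed trapped sphere to the causal future of the data HAS an event
horizon.  Open in the tree (p164880 derives it FROM the two Bondi cruxes); a censorship-infrastructure lemma. -/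
def TrappedHasHorizon : Prop :=
  ∀ (X : Type) [TopologicalSpace X] [ChartedSpace E3 X] [IsManifold (𝓡 3) ∞ X] [T2Space X]
    [SecondCountableTopology X] [ConnectedSpace X],
    ∀ D ∈ admissibleVacuumData X, ∀ 𝒟 : VacuumCauchyDevelopment D, 𝒟.IsMaximal →
      Summit.FinalStateConjecture.HasCompleteNullInfinity 𝒟.toCauchyDevelopment → HasTrappedSphere 𝒟 →
        HasHorizon 𝒟

/-- The unrelativised strengthening gives the relativised one (drop a hypothesis). -/
theorem persistentMassTrapsH_of_persistentMassTraps (h : PersistentMassTraps) : PersistentMassTrapsH :=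
  fun X _ _ _ _ _ _ D hD 𝒟 h𝒟 hI _ hm ↦ h X D hD 𝒟 h𝒟 hI hm

/-- **D2 assembly (proved)**: `PersistentMassTrapsH → TrappedHasHorizon → HorizonlessMustDrain` — by contradiction,
a non-draining horizonless censored development would contain a trapped sphere, hence a horizon. -/
theorem crux_of_trapsH (hP : PersistentMassTrapsH) (hT : TrappedHasHorizon) : HorizonlessMustDrain := by
  intro X _ _ _ _ _ _ D hD 𝒟 h𝒟 hI hH
  by_contra hm
  exact hH (hT X D hD 𝒟 h𝒟 hI (hP X D hD 𝒟 h𝒟 hI hH hm))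

/-- … and the Christodoulou-shape strengthening decides the crux with the censorship lemma. -/
theorem crux_of_traps (hP : PersistentMassTraps) (hT : TrappedHasHorizon) : HorizonlessMustDrain :=
  crux_of_trapsH (persistentMassTrapsH_of_persistentMassTraps hP) hT

/-- **COSTUME CHECK (proved): the crux gives `PersistentMassTrapsH` outright** — under the crux the three hypotheses
"censored, horizonless, not draining" are contradictory, so the relativised strengthening holds vacuously.  Hence
`PersistentMassTrapsH ↔ HorizonlessMustDrain` modulo `TrappedHasHorizon`: the relativised trapped-surface form is the
crux reworded, not a strategy. -/
theorem persistentMassTrapsH_of_crux (h : HorizonlessMustDrain) : PersistentMassTrapsH :=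
  fun X _ _ _ _ _ _ D hD 𝒟 h𝒟 hI hH hm ↦ absurd (h X D hD 𝒟 h𝒟 hI hH) hm

/-- The equivalence modulo the censorship lemma, recorded. -/
theorem persistentMassTrapsH_iff_crux (hT : TrappedHasHorizon) : PersistentMassTrapsH ↔ HorizonlessMustDrain :=
  ⟨fun hP ↦ crux_of_trapsH hP hT, persistentMassTrapsH_of_crux⟩

/-! ## D1 — the sector split (landed: `horizonlessMustDrain_iff_sectors` p157550, glue `HorizonlessMustDrain_of_subs`
p171331); restated over the abbreviations to fix the signatures used in the census. -/

/-- D1a `CompleteSector`: every future causally geodesically complete MGHD of an admissible datum drains. -/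
def CompleteSector : Prop :=
  ∀ (X : Type) [TopologicalSpace X] [ChartedSpace E3 X] [IsManifold (𝓡 3) ∞ X] [T2Space X]
    [SecondCountableTopology X] [ConnectedSpace X],
    ∀ D ∈ admissibleVacuumData X, ∀ 𝒟 : VacuumCauchyDevelopment D, 𝒟.IsMaximal → IsFutureComplete 𝒟 →
      𝒟.toCauchyDevelopment.HasVanishingFinalBondiMass

/-- D1b `IncompleteSector`: a censored, horizonless, future causally geodesically INCOMPLETE MGHD drains. -/
def IncompleteSector : Prop :=
  ∀ (X : Type) [TopologicalSpace X] [ChartedSpace E3 X] [IsManifold (𝓡 3) ∞ X] [T2Space X]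
    [SecondCountableTopology X] [ConnectedSpace X],
    ∀ D ∈ admissibleVacuumData X, ∀ 𝒟 : VacuumCauchyDevelopment D, 𝒟.IsMaximal →
      Summit.FinalStateConjecture.HasCompleteNullInfinity 𝒟.toCauchyDevelopment → ¬ HasHorizon 𝒟 →
        ¬ IsFutureComplete 𝒟 → 𝒟.toCauchyDevelopment.HasVanishingFinalBondiMass

/-- The landed equivalence, over the abbreviations (definitional unfolding only). -/
theorem crux_iff_sectors : HorizonlessMustDrain ↔ CompleteSector ∧ IncompleteSector := by
  refine ⟨fun h ↦ ⟨fun X _ _ _ _ _ _ D hD 𝒟 h𝒟 hc ↦ ?_, fun X _ _ _ _ _ _ D hD 𝒟 h𝒟 hI hH _ ↦ h X D hD 𝒟 h𝒟 hI hH⟩,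
    fun ⟨hC, hI⟩ X _ _ _ _ _ _ D hD 𝒟 h𝒟 hscri hH ↦ ?_⟩
  · -- complete sector from the crux: the landed direction of p157550
    exact (Summit.FinalStateConjecture.FinalStateConjecture.Theorems.BondiDrainDispersalHorizonlessMustDrain.horizonlessMustDrain_iff_sectors.1
      h).1 X D hD 𝒟 h𝒟 hc
  · by_cases hc : IsFutureComplete 𝒟
    · exact hC X D hD 𝒟 h𝒟 hc
    · exact hI X D hD 𝒟 h𝒟 hscri hH hc

/-- D1c `HorizonlessIsComplete` (stub C of line `birth`; conjecturally TRUE, makes `IncompleteSector` vacuous): a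
censored horizonless MGHD of an admissible datum is future causally geodesically complete.  Via (★) of p161294 it
would imply "future null complete ⇒ future timelike complete" for vacuum MGHDs of admissible data (W3 p156437 + W6
p156711 make every event of a null-complete MGHD visible and its `𝓘⁺` complete) — a global statement about the
Einstein flow, not causal bookkeeping. -/
def HorizonlessIsComplete : Prop :=
  ∀ (X : Type) [TopologicalSpace X] [ChartedSpace E3 X] [IsManifold (𝓡 3) ∞ X] [T2Space X]
    [SecondCountableTopology X] [ConnectedSpace X],
    ∀ D ∈ admissibleVacuumData X, ∀ 𝒟 : VacuumCauchyDevelopment D, 𝒟.IsMaximal →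
      Summit.FinalStateConjecture.HasCompleteNullInfinity 𝒟.toCauchyDevelopment → ¬ HasHorizon 𝒟 →
        IsFutureComplete 𝒟

/-- Stub C empties the incomplete sector (one line; = `incompleteSector_of_C` of p157550). -/
theorem incompleteSector_of_horizonlessIsComplete (hC : HorizonlessIsComplete) : IncompleteSector :=
  fun X _ _ _ _ _ _ D hD 𝒟 h𝒟 hI hH hc ↦ (hc (hC X D hD 𝒟 h𝒟 hI hH)).elim

/-- So under stub C the crux IS its complete sector. -/
theorem crux_iff_completeSector_of_horizonlessIsComplete (hC : HorizonlessIsComplete) :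
    HorizonlessMustDrain ↔ CompleteSector :=
  ⟨fun h ↦ (crux_iff_sectors.1 h).1,
    fun h ↦ crux_iff_sectors.2 ⟨h, incompleteSector_of_horizonlessIsComplete hC⟩⟩

/-! ## D3 — small data / large data (the small piece is Christodoulou–Klainerman Ch. 17, inside S's proved regime) -/

/-- D3 over an ABSTRACT smallness predicate `Small` on data (the CK global smallness condition is not typed in the
tree): the split `crux ⇐ (small ⇒ drains) ∧ (¬ small ⇒ crux-instance)` is excluded middle; the large piece is the
crux on the complement of a neighbourhood of Minkowski data, i.e. the whole open content. -/
theorem crux_of_small_large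
    (Small : ∀ {X : Type} [TopologicalSpace X] [ChartedSpace E3 X] [IsManifold (𝓡 3) ∞ X],
      InitialDataSet (𝓡 3) X → Prop)
    (hS : ∀ (X : Type) [TopologicalSpace X] [ChartedSpace E3 X] [IsManifold (𝓡 3) ∞ X] [T2Space X]
      [SecondCountableTopology X] [ConnectedSpace X],
      ∀ D ∈ admissibleVacuumData X, Small D → ∀ 𝒟 : VacuumCauchyDevelopment D, 𝒟.IsMaximal →
        𝒟.toCauchyDevelopment.HasVanishingFinalBondiMass)
    (hL : ∀ (X : Type) [TopologicalSpace X] [ChartedSpace E3 X] [IsManifold (𝓡 3) ∞ X] [T2Space X]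
      [SecondCountableTopology X] [ConnectedSpace X],
      ∀ D ∈ admissibleVacuumData X, ¬ Small D → ∀ 𝒟 : VacuumCauchyDevelopment D, 𝒟.IsMaximal →
        Summit.FinalStateConjecture.HasCompleteNullInfinity 𝒟.toCauchyDevelopment → ¬ HasHorizon 𝒟 →
          𝒟.toCauchyDevelopment.HasVanishingFinalBondiMass) :
    HorizonlessMustDrain := by
  intro X _ _ _ _ _ _ D hD 𝒟 h𝒟 hI hH
  by_cases hs : Small D
  · exact hS X D hD hs 𝒟 h𝒟
  · exact hL X D hD hs 𝒟 h𝒟 hI hH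

/-! ## T1 — the first non-transferring step of the spherical proof: uniformly non-trapped developments -/

/-- **`UniformlyNonTrappedDrains`** (the step of Christodoulou CMP 109 (1987) §§3–5 / CPAM 46 (1993) that the
vacuum problem lacks: "`1 - 2m/r` bounded below for all time ⇒ the field decays and the Bondi mass drains").
Typed with the tree's `nullExpansion`: a censored horizonless MGHD in which, for some `δ > 0`, EVERY compact
spacelike embedded 2-sphere to the causal future of the data and every null normal pair has normalised mean
expansion product `(16π)⁻¹ ∫ θ_L θ_L̲ dA ≤ -δ` (i.e. `2 m_H / r ≤ 1 - δ`: uniformly far from marginal trapping)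
has vanishing final Bondi mass.  Strictly weaker than `CompleteSector` in intent (stronger hypothesis), open, and
with no vacuum mechanism in print: the spherical proof closes it by 1+1 characteristic estimates. -/
def UniformlyNonTrappedDrains : Prop :=
  ∀ (X : Type) [TopologicalSpace X] [ChartedSpace E3 X] [IsManifold (𝓡 3) ∞ X] [T2Space X]
    [SecondCountableTopology X] [ConnectedSpace X],
    ∀ D ∈ admissibleVacuumData X, ∀ 𝒟 : VacuumCauchyDevelopment D, 𝒟.IsMaximal →
      Summit.FinalStateConjecture.HasCompleteNullInfinity 𝒟.toCauchyDevelopment → ¬ HasHorizon 𝒟 →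
      (∀ [𝒟.metric.HasLeviCivita], ∃ δ : ℝ, 0 < δ ∧
        ∀ (f : Metric.sphere (0 : E3) 1 → 𝒟.carrier),
          Set.range f ⊆ 𝒟.metric.causalFuture 𝒟.timeOrientation (Set.range 𝒟.embed) →
          Manifold.IsSmoothEmbedding (𝓡 2) (𝓡 4) ∞ f →
          ∀ (hpb : PseudoRiemannianMetric.contMDiff_pullbackBilin (𝓡 4) 𝒟.carrier (𝓡 2) (Metric.sphere (0 : E3) 1) ∞)
            (hf : 𝒟.metric.IsSpacelikeImmersion (𝓡 2) f)
            (P : LorentzianMetric.NullNormalPair (𝓡 2) 𝒟.metric 𝒟.timeOrientation f),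
            (16 * Real.pi)⁻¹ * ∫ y, 𝒟.metric.nullExpansion f hpb hf P.L y * 𝒟.metric.nullExpansion f hpb hf P.Lbar y
                ∂(riemannianVolume (𝒟.metric.inducedRiemannianMetric f hpb hf) 2) ≤ -δ) →
      𝒟.toCauchyDevelopment.HasVanishingFinalBondiMass

/-- The crux gives `UniformlyNonTrappedDrains` (drop the non-trapping hypothesis): it IS strictly downstream. -/
theorem uniformlyNonTrappedDrains_of_crux (h : HorizonlessMustDrain) : UniformlyNonTrappedDrains :=
  fun X _ _ _ _ _ _ D hD 𝒟 h𝒟 hI hH _ ↦ h X D hD 𝒟 h𝒟 hI hH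

end Summit.FinalStateConjecture.FinalStateConjecture.Cruxes.HorizonlessMustDrain.CensusS4

end
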